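import Summits.SmoothPoincare4.SmoothPoincare4.Theorems.ContractibleTwistedDoubleStandard.Negative.LoadBearing
import Literature.Topology.FourManifolds.Gluing

/-!
# `ContractibleTwistedDoubleStandard` — negative-side support: contact gluings and redundant hypotheses

Support lemmas for the crux
`Summit.SmoothPoincare4.SmoothPoincare4.Theses.ConvexBisection.ContractibleTwistedDoubleStandard`
(stmt-SmoothPoincare4-3546), from the standing disprover's work file
`Cruxes/ContractibleTwistedDoubleStandard/Disproof.lean` (cycle 2, §§6–7):

* `exists_mfderiv_incl_comp_eq` — for a diffeomorphism `ψ : ∂W₁ ≃ ∂W₂` of abstract boundaries,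
  `d(incl₂ ∘ ψ)` maps ONTO the boundary hyperplane `T∂W₂` ((A2) of `Negative.DoubleBisection` plus
  invertibility of `dψ`);
* `steinBisection_of_contactGluing` — **every gluing `W₁ ∪_ψ W₂` of two compact Stein domains along
  a CONTACTOMORPHISM `ψ` of the abstract boundaries** (a diffeomorphism whose differential carries
  the pulled-back complex tangencies `d(incl₁)⁻¹ ξ₁` onto `d(incl₂ ∘ ψ)⁻¹ ξ₂` — the predicate the
  line `legendrian-r-knot-rigidity` calls `IsContacto`, written out) **satisfies the six hypotheses
  of the crux**; this generalises `steinBisection_of_glue` (`ψ = id`, one Stein structure) to two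
  domains, two Stein structures and any contactomorphism, i.e. it is the converse half of the
  folklore seam lemma (`stub_seam` of the lines): the crux is (at least) the statement "contact
  twisted doubles `W₁ ∪_ψ W̄₂` of contractible compact Stein domains are `S⁴`";
* `contactGluing_standard_of_crux` — hence the crux implies: every (Hausdorff, second countable)
  boundary gluing of two contractible compact Stein domains along a contactomorphism is `S⁴`;
  `contactCorkTwist_standard_of_crux` — in particular every twist `C ∪_τ C` of a contractible
  compact Stein domain `C` by a contactomorphism `τ` of `(∂C, ξ_J)` is `S⁴` (the contact sector of
  Gompf's Question 2.2, arXiv:1603.05090 p. 8, and the "contact cork" falsifier F0 of the lines: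
  a cork `(C, τ)` with `τ` a contactomorphism of a `C`-Stein-induced `ξ` and `C ∪_τ C̄` exotic would
  refute the crux — none is known; for the Akbulut cork `τ` is not even a contactomorphism of the
  handlebody structure, Akbulut–Karakurt arXiv:1104.2247 Thm 4.1);
* `crux_iff_minimal` — `[CompactSpace X]` AND `[SecondCountableTopology X]` are REDUNDANT in the
  crux (the cover by two compact images gives compactness, `compactSpace_of_cover`; a compact space
  charted over `ℝ⁴` is second countable, `ChartedSpace.secondCountable_of_sigmaCompact`).
  (`[T2Space X]` is NOT redundant on paper: doubling a small interior ball of `𝔻⁴` gives a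
  non-Hausdorff compact contractible "Stein domain" in the sense of `SteinStructure`, all of whose
  axioms are local; not formalised.)
-/

noncomputable section

open scoped Manifold ContDiff Topology
open Set Function Literature.Geometry.Symplectic Literature.Topology.FourManifolds

namespace Summit.SmoothPoincare4.SmoothPoincare4.Theorems.ContractibleTwistedDoubleStandard.Negative

open Summit.SmoothPoincare4.SmoothPoincare4.Theses.ConvexBisection

section ContactGluing

variable {W₁ : Type*} [TopologicalSpace W₁] [ChartedSpace (EuclideanHalfSpace 4) W₁]
  [IsManifold (𝓡∂ 4) ∞ W₁]
  {W₂ : Type*} [TopologicalSpace W₂] [ChartedSpace (EuclideanHalfSpace 4) W₂]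
  [IsManifold (𝓡∂ 4) ∞ W₂]

omit [IsManifold (𝓡∂ 4) ∞ W₁] in
/-- **`d(incl₂ ∘ ψ)` maps onto the boundary hyperplane** for a diffeomorphism `ψ` of abstract
boundaries: every `w ∈ T∂W₂ = {v | v 0 = 0}` at `incl₂ (ψ z)` is `d(incl₂ ∘ ψ)_z u` for some `u`
((A2) `exists_mfderiv_incl_eq` for `b₂` at `ψ z`, and `u := dψ⁻¹ u'` by the chain rule on
`ψ ∘ ψ⁻¹ = id`). [folklore] -/
theorem exists_mfderiv_incl_comp_eq (b₁ : BoundaryData (𝓡∂ 4) W₁ (𝓡 3))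
    (b₂ : BoundaryData (𝓡∂ 4) W₂ (𝓡 3)) (ψ : b₁.carrier ≃ₘ⟮𝓡 3, 𝓡 3⟯ b₂.carrier)
    (z : b₁.carrier) {w : EuclideanSpace ℝ (Fin 4)} (hw : w ∈ boundaryTangentSpace) :
    ∃ u : EuclideanSpace ℝ (Fin 3), mfderiv (𝓡 3) (𝓡∂ 4) (b₂.incl ∘ ψ) z u = w := by
  obtain ⟨u', hu'⟩ := exists_mfderiv_incl_eq b₂ (ψ z) hw
  have hψ : MDifferentiableAt (𝓡 3) (𝓡 3) ψ z := ψ.mdifferentiable (by simp) _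
  have hψ' : MDifferentiableAt (𝓡 3) (𝓡 3) ψ (ψ.symm (ψ z)) := ψ.mdifferentiable (by simp) _
  have hψs : MDifferentiableAt (𝓡 3) (𝓡 3) ψ.symm (ψ z) := ψ.symm.mdifferentiable (by simp) _
  have hi₂ : MDifferentiableAt (𝓡 3) (𝓡∂ 4) b₂.incl (ψ z) :=
    b₂.isSmoothEmbedding.contMDiff.mdifferentiableAt (by simp)
  refine ⟨mfderiv (𝓡 3) (𝓡 3) ψ.symm (ψ z) u', ?_⟩
  -- `dψ (dψ⁻¹ u') = u'`
  have key : mfderiv (𝓡 3) (𝓡 3) ψ (ψ.symm (ψ z)) (mfderiv (𝓡 3) (𝓡 3) ψ.symm (ψ z) u') = u' := by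
    rw [← mfderiv_comp_apply (ψ z) hψ' hψs u']
    have hid : ((ψ : b₁.carrier → b₂.carrier) ∘ (ψ.symm : b₂.carrier → b₁.carrier)) = id :=
      funext fun x => ψ.apply_symm_apply x
    rw [hid, mfderiv_id]
    rfl
  rw [ψ.symm_apply_apply] at key
  rw [mfderiv_comp_apply z hi₂ hψ]
  exact (congrArg (mfderiv (𝓡 3) (𝓡∂ 4) b₂.incl (ψ z)) key).trans hu'

variable [CompactSpace W₁] [CompactSpace W₂]

/-- **Gluing two compact Stein domains along a contactomorphism of their boundaries gives a Stein
bisection along a common contact seam** — the six hypotheses of the crux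
`ConvexBisection.ContractibleTwistedDoubleStandard` for `(P; W₁, W₂; S₁, S₂; jA, jB)` whenever
`jA`, `jB` are smooth embeddings covering `P` and meeting exactly in `incl₁ z ↔ incl₂ (ψ z)`
(`IsBoundaryGluing b₁ b₂ ψ`, unfolded) and `ψ` is a contactomorphism in the differential sense:
`d(incl₂ ∘ ψ)_z v ∈ ξ₂ ↔ d(incl₁)_z v ∈ ξ₁` (no co-orientation recorded, exactly as in the crux's
matching clause; this is `IsContacto S₁ S₂ b₁ b₂ ψ` of line `legendrian-r-knot-rigidity`, written
out). The plane matching: `ξ₁ ≤ T∂W₁ = d(incl₁)(T_z)` by (A2), `ξ₂ ≤ T∂W₂ = d(incl₂ ∘ ψ)(T_z)` by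
`exists_mfderiv_incl_comp_eq`, and `d jA ∘ d incl₁ = d jB ∘ d(incl₂ ∘ ψ)` by the chain rule on
`jA ∘ incl₁ = jB ∘ incl₂ ∘ ψ`. Generalises `steinBisection_of_glue` (`ψ = id`, `S₁ = S₂`).
[folklore] -/
theorem steinBisection_of_contactGluing {P : Type*} [TopologicalSpace P]
    [ChartedSpace (EuclideanSpace ℝ (Fin 4)) P]
    (b₁ : BoundaryData (𝓡∂ 4) W₁ (𝓡 3)) (b₂ : BoundaryData (𝓡∂ 4) W₂ (𝓡 3))
    (S₁ : SteinStructure W₁) (S₂ : SteinStructure W₂)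
    (ψ : b₁.carrier ≃ₘ⟮𝓡 3, 𝓡 3⟯ b₂.carrier)
    (hψ : ∀ (z : b₁.carrier) (v : EuclideanSpace ℝ (Fin 3)),
      mfderiv (𝓡 3) (𝓡∂ 4) (b₂.incl ∘ ψ) z v ∈ contactPlane S₂.J (b₂.incl (ψ z)) ↔
        mfderiv (𝓡 3) (𝓡∂ 4) b₁.incl z v ∈ contactPlane S₁.J (b₁.incl z))
    {jA : W₁ → P} {jB : W₂ → P}
    (hA : Manifold.IsSmoothEmbedding (𝓡∂ 4) (𝓡 4) ∞ jA)
    (hB : Manifold.IsSmoothEmbedding (𝓡∂ 4) (𝓡 4) ∞ jB) (hU : range jA ∪ range jB = univ)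
    (hR : ∀ a a', jA a = jB a' ↔ ∃ z, a = b₁.incl z ∧ a' = b₂.incl (ψ z)) :
    Manifold.IsSmoothEmbedding (𝓡∂ 4) (𝓡 4) ∞ jA ∧ Manifold.IsSmoothEmbedding (𝓡∂ 4) (𝓡 4) ∞ jB ∧
      range jA ∪ range jB = univ ∧ range jA ∩ range jB = jA '' (𝓡∂ 4).boundary W₁ ∧
      range jA ∩ range jB = jB '' (𝓡∂ 4).boundary W₂ ∧
      (∀ w₁ w₂, jA w₁ = jB w₂ →
        Submodule.map (mfderiv (𝓡∂ 4) (𝓡 4) jA w₁).toLinearMap (contactPlane S₁.J w₁) =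
          Submodule.map (mfderiv (𝓡∂ 4) (𝓡 4) jB w₂).toLinearMap (contactPlane S₂.J w₂)) := by
  have hcomp : jA ∘ b₁.incl = jB ∘ (b₂.incl ∘ ψ) := funext fun z => (hR _ _).2 ⟨z, rfl, rfl⟩
  refine ⟨hA, hB, hU, ?_, ?_, ?_⟩
  · ext p
    constructor
    · rintro ⟨⟨a, rfl⟩, ⟨a', ha'⟩⟩
      obtain ⟨z, rfl, -⟩ := (hR a a').1 ha'.symm
      exact ⟨b₁.incl z, b₁.incl_mem_boundary z, rfl⟩
    · rintro ⟨a, ha, rfl⟩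
      rw [← b₁.range_incl] at ha
      obtain ⟨z, rfl⟩ := ha
      exact ⟨mem_range_self _, ⟨b₂.incl (ψ z), ((hR _ _).2 ⟨z, rfl, rfl⟩).symm⟩⟩
  · ext p
    constructor
    · rintro ⟨⟨a, ha⟩, ⟨a', rfl⟩⟩
      obtain ⟨z, -, rfl⟩ := (hR a a').1 ha
      exact ⟨b₂.incl (ψ z), b₂.incl_mem_boundary _, rfl⟩
    · rintro ⟨a, ha, rfl⟩
      rw [← b₂.range_incl] at ha
      obtain ⟨y, rfl⟩ := ha
      refine ⟨⟨b₁.incl (ψ.symm y), ?_⟩, mem_range_self _⟩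
      have := (hR (b₁.incl (ψ.symm y)) (b₂.incl (ψ (ψ.symm y)))).2 ⟨ψ.symm y, rfl, rfl⟩
      rwa [ψ.apply_symm_apply] at this
  · intro w₁ w₂ hw
    obtain ⟨z, rfl, rfl⟩ := (hR w₁ w₂).1 hw
    -- differentiability data for the chain rule along the seam
    have hi₁ : MDifferentiableAt (𝓡 3) (𝓡∂ 4) b₁.incl z :=
      b₁.isSmoothEmbedding.contMDiff.mdifferentiableAt (by simp)
    have hi₂ : MDifferentiableAt (𝓡 3) (𝓡∂ 4) (b₂.incl ∘ ψ) z :=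
      (b₂.isSmoothEmbedding.contMDiff.comp ψ.contMDiff).mdifferentiableAt (by simp)
    have hjA : MDifferentiableAt (𝓡∂ 4) (𝓡 4) jA (b₁.incl z) :=
      hA.contMDiff.mdifferentiableAt (by simp)
    have hjB : MDifferentiableAt (𝓡∂ 4) (𝓡 4) jB ((b₂.incl ∘ ψ) z) :=
      hB.contMDiff.mdifferentiableAt (by simp)
    have chain : ∀ u : EuclideanSpace ℝ (Fin 3),
        mfderiv (𝓡∂ 4) (𝓡 4) jA (b₁.incl z) (mfderiv (𝓡 3) (𝓡∂ 4) b₁.incl z u) =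
          mfderiv (𝓡∂ 4) (𝓡 4) jB (b₂.incl (ψ z)) (mfderiv (𝓡 3) (𝓡∂ 4) (b₂.incl ∘ ψ) z u) := by
      intro u
      rw [← mfderiv_comp_apply z hjA hi₁ u, hcomp]
      exact mfderiv_comp_apply z hjB hi₂ u
    ext x
    simp only [Submodule.mem_map]
    constructor
    · rintro ⟨v, hv, rfl⟩
      obtain ⟨u, rfl⟩ := exists_mfderiv_incl_eq b₁ z (contactPlane_le_boundaryTangentSpace S₁.J _ hv)
      refine ⟨mfderiv (𝓡 3) (𝓡∂ 4) (b₂.incl ∘ ψ) z u, (hψ z u).2 hv, ?_⟩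
      exact (chain u).symm
    · rintro ⟨w, hw', rfl⟩
      obtain ⟨u, rfl⟩ :=
        exists_mfderiv_incl_comp_eq b₁ b₂ ψ z (contactPlane_le_boundaryTangentSpace S₂.J _ hw')
      exact ⟨mfderiv (𝓡 3) (𝓡∂ 4) b₁.incl z u, (hψ z u).1 hw', chain u⟩

/-- **The crux implies: every boundary gluing `W₁ ∪_ψ W₂` of two contractible compact Stein domains
along a contactomorphism `ψ` of their Stein-induced contact boundaries is `S⁴`** (for a Hausdorff,
second countable smooth `P` realising the gluing, `IsBoundaryGluing b₁ b₂ ψ (𝓡 4) P`). With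
`ψ = id`, `W₁ = W₂`, `S₁ = S₂` this is `double_standard_of_crux` (presentation-sphere sector); with
`W₁ = W₂` and `ψ = τ` a contactomorphism it is the contact sector of cork twisting `S⁴`
(`contactCorkTwist_standard_of_crux`). So any refutation of the crux is an exotic contact twisted
double, and conversely every such kills it. [folklore] -/
theorem contactGluing_standard_of_crux (h : ContractibleTwistedDoubleStandard)
    (W₁ : Type) [TopologicalSpace W₁] [ChartedSpace (EuclideanHalfSpace 4) W₁]
    [IsManifold (𝓡∂ 4) ∞ W₁] [CompactSpace W₁] [ContractibleSpace W₁]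
    (W₂ : Type) [TopologicalSpace W₂] [ChartedSpace (EuclideanHalfSpace 4) W₂]
    [IsManifold (𝓡∂ 4) ∞ W₂] [CompactSpace W₂] [ContractibleSpace W₂]
    (S₁ : SteinStructure W₁) (S₂ : SteinStructure W₂)
    (b₁ : BoundaryData (𝓡∂ 4) W₁ (𝓡 3)) (b₂ : BoundaryData (𝓡∂ 4) W₂ (𝓡 3))
    (ψ : b₁.carrier ≃ₘ⟮𝓡 3, 𝓡 3⟯ b₂.carrier)
    (hψ : ∀ (z : b₁.carrier) (v : EuclideanSpace ℝ (Fin 3)),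
      mfderiv (𝓡 3) (𝓡∂ 4) (b₂.incl ∘ ψ) z v ∈ contactPlane S₂.J (b₂.incl (ψ z)) ↔
        mfderiv (𝓡 3) (𝓡∂ 4) b₁.incl z v ∈ contactPlane S₁.J (b₁.incl z))
    (P : Type) [TopologicalSpace P] [T2Space P] [SecondCountableTopology P]
    [ChartedSpace (EuclideanSpace ℝ (Fin 4)) P] [IsManifold (𝓡 4) ∞ P]
    (hG : IsBoundaryGluing b₁ b₂ ψ (𝓡 4) P) :
    Nonempty (P ≃ₘ⟮𝓡 4, 𝓡 4⟯ (Metric.sphere (0 : EuclideanSpace ℝ (Fin 5)) 1)) := by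
  obtain ⟨jA, jB, hA, hB, hU, hR⟩ := hG
  obtain ⟨-, -, -, hL, hR', hC⟩ := steinBisection_of_contactGluing b₁ b₂ S₁ S₂ ψ hψ hA hB hU hR
  haveI : CompactSpace P := compactSpace_of_cover hA hB hU
  exact h P W₁ W₂ S₁ S₂ jA jB hA hB hU hL hR' hC

/-- **The crux implies the contact sector of cork twisting `S⁴`**: for a contractible compact Stein
domain `C` and a self-diffeomorphism `τ` of its abstract boundary which is a contactomorphism of
`ξ_J` (differential form), every Hausdorff second countable smooth `P` realising the twisted
double `C ∪_τ C` is `S⁴`. A cork `(C, τ)` (`Literature.Topology.FourManifolds.IsCork`) with `τ` a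
contactomorphism of some `C`-Stein-induced contact structure and `C ∪_τ C̄` exotic would therefore
refute the crux (none known: Gompf arXiv:1603.05090 Question 2.2 is open even smoothly; on the
Akbulut cork `τ` moves the contact invariant of the handlebody structure, Akbulut–Karakurt
arXiv:1104.2247 Thm 4.1 / Cor 4.2–4.3, so `τ` is no contactomorphism there). [folklore] -/
theorem contactCorkTwist_standard_of_crux (h : ContractibleTwistedDoubleStandard)
    (C : Type) [TopologicalSpace C] [ChartedSpace (EuclideanHalfSpace 4) C]
    [IsManifold (𝓡∂ 4) ∞ C] [CompactSpace C] [ContractibleSpace C]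
    (S : SteinStructure C) (b : BoundaryData (𝓡∂ 4) C (𝓡 3))
    (τ : b.carrier ≃ₘ⟮𝓡 3, 𝓡 3⟯ b.carrier)
    (hτ : ∀ (z : b.carrier) (v : EuclideanSpace ℝ (Fin 3)),
      mfderiv (𝓡 3) (𝓡∂ 4) (b.incl ∘ τ) z v ∈ contactPlane S.J (b.incl (τ z)) ↔
        mfderiv (𝓡 3) (𝓡∂ 4) b.incl z v ∈ contactPlane S.J (b.incl z))
    (P : Type) [TopologicalSpace P] [T2Space P] [SecondCountableTopology P]
    [ChartedSpace (EuclideanSpace ℝ (Fin 4)) P] [IsManifold (𝓡 4) ∞ P]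
    (hG : IsBoundaryGluing b b τ (𝓡 4) P) :
    Nonempty (P ≃ₘ⟮𝓡 4, 𝓡 4⟯ (Metric.sphere (0 : EuclideanSpace ℝ (Fin 5)) 1)) :=
  contactGluing_standard_of_crux h C C S S b b τ hτ P hG

end ContactGluing

/-- **`[CompactSpace X]` and `[SecondCountableTopology X]` are both redundant**: the crux is
equivalent to its version with neither (the two compact images cover `X`, `compactSpace_of_cover`;
a compact space charted over `ℝ⁴` is second countable, `ChartedSpace.secondCountable_of_sigmaCompact`).
[folklore] -/
theorem crux_iff_minimal : ContractibleTwistedDoubleStandard ↔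
    ∀ (X : Type) [TopologicalSpace X] [T2Space X]
      [ChartedSpace (EuclideanSpace ℝ (Fin 4)) X] [IsManifold (𝓡 4) ∞ X]
      (W₁ : Type) [TopologicalSpace W₁] [ChartedSpace (EuclideanHalfSpace 4) W₁]
      [IsManifold (𝓡∂ 4) ∞ W₁] [CompactSpace W₁] [ContractibleSpace W₁]
      (W₂ : Type) [TopologicalSpace W₂] [ChartedSpace (EuclideanHalfSpace 4) W₂]
      [IsManifold (𝓡∂ 4) ∞ W₂] [CompactSpace W₂] [ContractibleSpace W₂]
      (J₁ : SteinStructure W₁) (J₂ : SteinStructure W₂) (e₁ : W₁ → X) (e₂ : W₂ → X),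
      Manifold.IsSmoothEmbedding (𝓡∂ 4) (𝓡 4) ∞ e₁ → Manifold.IsSmoothEmbedding (𝓡∂ 4) (𝓡 4) ∞ e₂ →
      range e₁ ∪ range e₂ = univ →
      range e₁ ∩ range e₂ = e₁ '' (𝓡∂ 4).boundary W₁ →
      range e₁ ∩ range e₂ = e₂ '' (𝓡∂ 4).boundary W₂ →
      (∀ w₁ w₂, e₁ w₁ = e₂ w₂ →
        Submodule.map (mfderiv (𝓡∂ 4) (𝓡 4) e₁ w₁).toLinearMap (contactPlane J₁.J w₁) =
          Submodule.map (mfderiv (𝓡∂ 4) (𝓡 4) e₂ w₂).toLinearMap (contactPlane J₂.J w₂)) →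
      Nonempty (X ≃ₘ⟮𝓡 4, 𝓡 4⟯ Metric.sphere (0 : EuclideanSpace ℝ (Fin 5)) 1) := by
  constructor
  · intro h X _ _ _ _ W₁ _ _ _ _ _ W₂ _ _ _ _ _ J₁ J₂ e₁ e₂ h1 h2 h3 h4 h5 h6
    haveI := compactSpace_of_cover h1 h2 h3
    haveI : SecondCountableTopology X :=
      ChartedSpace.secondCountable_of_sigmaCompact (EuclideanSpace ℝ (Fin 4)) X
    exact h X W₁ W₂ J₁ J₂ e₁ e₂ h1 h2 h3 h4 h5 h6
  · intro h X _ _ _ _ _ _ W₁ _ _ _ _ _ W₂ _ _ _ _ _ J₁ J₂ e₁ e₂ h1 h2 h3 h4 h5 h6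
    exact h X W₁ W₂ J₁ J₂ e₁ e₂ h1 h2 h3 h4 h5 h6

end Summit.SmoothPoincare4.SmoothPoincare4.Theorems.ContractibleTwistedDoubleStandard.Negative
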